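import Mathlib
import Literature.Combinatorics.Enumerative.InvolutionsAvoiding321
import HarnessLib

/-!
# `4321`-avoiding involutions are the nonnesting partial matchings (Barnabei–Bonetti–Silimbani 2011)

Layer `Literature/Combinatorics/Enumerative`, namespace `Literature.Combinatorics.Enumerative.PermContainsPattern`; lane
`lit-hodgefound` (prover seat p13, generation 39, theme «nonnesting matchings and restricted involutions»).  Companion
of `InvolutionsAvoiding321Structure.lean` / `InvolutionsAvoiding321.lean` (`321`: nonnesting AND no fixed point under an
arc; `I_n(321) = binom(n, [n/2])`).

## Source

M. Barnabei, F. Bonetti, M. Silimbani, *Restricted involutions and Motzkin paths*, Adv. Appl. Math. **47** (2011)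
102–115 = arXiv:0812.0463 [BarnabeiBonettiSilimbani2011] (held text `paper-arxiv-0812.0463`; numbering of the arXiv
version).  The authors encode an involution `τ` by a labelled Motzkin path `Φ(τ) = (M, λ)` (§3: up step at an excedance
`τ(i) > i`, horizontal step at a fixed point, down step at a deficiency `τ(i) < i` labelled by the rank of `τ(i)` among
the currently open excedances); the UNITARY labelling (every label `1`: each deficiency closes the smallest open
excedance, i.e. the arcs `(i, τ i)` are matched first-in-first-out — NO TWO ARCS NEST) is the subject of:

> **Theorem 2.** Let `τ` be an involution and `Φ(τ) = (M, λ)`. Then `τ` avoids the pattern `4321` if and only if `λ`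
> is the unitary labelling.
> **Proposition 3.** … `τ` avoids `321` if and only if `λ = υ` and all horizontal steps in `M` are at height `0`.
> **Theorem 6.** … ii. `|I_n(4321, 321)| = binom(n, ⌊n/2⌋)`; … («Obviously `I_n(4321,321) = I_n(321)`»).
> **Theorem 10.** There is a bijection between the set `DI_{2h}(4321)` and the set `𝒟_h` of Dyck paths of length `2h`.
> Hence `|DI_{2h}(4321)| = C_h`.
> **Proposition 11.** `DI_{2h}(321) = DI_{2h}(4321)`.

(`I_n(R)` = involutions of `[n]` avoiding every pattern in `R`; `DI_n` = fixed-point-free involutions.)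

## Formalisation (arc language; theorems only — no `def`, no instance, no notation, no named fact; net debt 0)

* §1 `contains_4321_iff` (positions `i < j < k < l` carrying decreasing letters).
* §2 ★★ `not_contains_4321_iff_nonnesting` — THEOREM 2: an involution avoids `4321` iff no two of its arcs nest
  (`contains_4321_of_nesting`; conversely in an occurrence `u p > u q > u r > u s` either `q` is an excedance — the
  arcs from `p` and `q` nest — or `r, s` are deficiencies whose arcs nest).
* §3 ★ `not_contains_321_iff_not_contains_4321` — PROPOSITION 3: `u` avoids `321` iff it avoids `4321` and no fixed
  point lies under an arc; `not_contains_4321_of_not_contains_321`, `card_involutions_av321_le_av4321`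
  (`I_n(321) ≤ I_n(4321)`).
* §4 ★ `fpf_not_contains_321_iff_not_contains_4321` / `setOf_fpf_involutions_av321_eq_av4321`,
  `card_fpf_involutions_av4321_eq_av321` — PROPOSITION 11 (`DI_n(321) = DI_n(4321)`);
  ★★ `card_fpf_involutions_av4321_two_mul` — THEOREM 10 (`|DI_{2h}(4321)| = C_h`, through the tree's nonnesting
  perfect matchings `nestFreeMatchings`), `card_fpf_involutions_av4321_odd`, `card_fpf_involutions_av4321_eq_ite`.
* §5 `card_involutions_av4321_av321` — THEOREM 6 (ii) (`|I_n(4321,321)| = binom(n, ⌊n/2⌋)`).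

Not here: `|I_n(4321)| = M_n` (Motzkin numbers are not in Mathlib or the tree yet), Theorem 6 (i), (iii), the
`3412` (noncrossing, maximal labelling) half of the paper.
-/

namespace Literature.Combinatorics.Enumerative

namespace PermContainsPattern

open Finset Equiv
open Literature.Computability.AlgebraicComplexity

variable {n m : ℕ}

/-! ### §1 Occurrences of `4321` -/

/-- `v` contains `4321` iff four positions `i < j < k < l` carry decreasing letters.
[cite: BarnabeiBonettiSilimbani2011, §2 (pattern containment; arXiv 0812.0463)] -/
theorem contains_4321_iff (v : Perm (Fin n)) :
    PermContainsPattern v ![4, 3, 2, 1] ↔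
      ∃ i j k l : Fin n, i < j ∧ j < k ∧ k < l ∧ v j < v i ∧ v k < v j ∧ v l < v k := by
  constructor
  · rintro ⟨f, hf, hfv⟩
    refine ⟨f 0, f 1, f 2, f 3, hf (by decide), hf (by decide), hf (by decide), ?_, ?_, ?_⟩
    · exact (hfv 1 0).1 (by decide)
    · exact (hfv 2 1).1 (by decide)
    · exact (hfv 3 2).1 (by decide)
  · rintro ⟨i, j, k, l, hij, hjk, hkl, h1, h2, h3⟩
    have hmono : StrictMono ![i, j, k, l] := by
      refine Fin.strictMono_iff_lt_succ.2 fun a => ?_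
      fin_cases a
      · exact hij
      · exact hjk
      · exact hkl
    have hanti : StrictAnti (fun a => v (![i, j, k, l] a)) := by
      refine Fin.strictAnti_iff_succ_lt.2 fun a => ?_
      fin_cases a
      · exact h1
      · exact h2
      · exact h3
    refine ⟨![i, j, k, l], hmono, fun a b => ?_⟩
    have hq : (![4, 3, 2, 1] : Fin 4 → ℕ) a < ![4, 3, 2, 1] b ↔ b < a := by
      fin_cases a <;> fin_cases b <;> decide
    rw [hq]
    exact (hanti.lt_iff_gt).symm

/-! ### §2 THEOREM 2: an involution avoids `4321` iff no two arcs nest -/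

/-- Two nesting arcs `i < j < u j < u i` of an involution give the occurrence `u i, u j, j, i` of `4321` (at the positions
`i < j < u j < u i`). [cite: BarnabeiBonettiSilimbani2011, Theorem 2 (proof; arXiv 0812.0463)] -/
theorem contains_4321_of_nesting {u : Perm (Fin n)} (hu : ∀ x, u (u x) = x) {i j : Fin n} (hij : i < j)
    (hj : j < u j) (hji : u j < u i) : PermContainsPattern u ![4, 3, 2, 1] :=
  (contains_4321_iff u).2 ⟨i, j, u j, u i, hij, hj, hji, hji, by rw [hu]; exact hj, by rw [hu, hu]; exact hij⟩

/-- Conversely, an involution whose arcs do not nest avoids `4321`: in an occurrence `u p > u q > u r > u s`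
(`p < q < r < s`), if `q` is an excedance then `p < q < u q < u p` nest; otherwise `r` and `s` are deficiencies and
`u s < u r < r < s` nest («`τ` is obtained by interlacing the three increasing sequences of fixed points, excedances
and deficiencies, and hence cannot contain any decreasing subsequence of length `4`»).
[cite: BarnabeiBonettiSilimbani2011, Theorem 2 (arXiv 0812.0463)] -/
theorem not_contains_4321_of_nonnesting {u : Perm (Fin n)} (hu : ∀ x, u (u x) = x)
    (hnn : ∀ i j : Fin n, i < j → j < u j → u j < u i → False) : ¬ PermContainsPattern u ![4, 3, 2, 1] := by
  intro h
  obtain ⟨p, q, r, s, hpq, hqr, hrs, h1, h2, h3⟩ := (contains_4321_iff u).1 h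
  by_cases hq : q < u q
  · exact hnn p q hpq hq h1
  · -- `u q ≤ q`, so `u r < q < r` and `u s < u r`: `r`, `s` are deficiencies with nesting arcs
    have hr : u r < r := (h2.trans_le (not_lt.1 hq)).trans hqr
    exact hnn (u s) (u r) h3 (by rw [hu]; exact hr) (by rw [hu, hu]; exact hrs)

/-- ★★ **THEOREM 2 (Barnabei–Bonetti–Silimbani).** An involution avoids `4321` iff its arc diagram is nonnesting
(the labelling of its Motzkin path is unitary: every deficiency closes the earliest open excedance).
[cite: BarnabeiBonettiSilimbani2011, Theorem 2 (arXiv 0812.0463)] -/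
theorem not_contains_4321_iff_nonnesting {u : Perm (Fin n)} (hu : ∀ x, u (u x) = x) :
    ¬ PermContainsPattern u ![4, 3, 2, 1] ↔ ∀ i j : Fin n, i < j → j < u j → u j < u i → False :=
  ⟨fun h _ _ hij hj hji => h (contains_4321_of_nesting hu hij hj hji), not_contains_4321_of_nonnesting hu⟩

/-! ### §3 PROPOSITION 3: `321` = `4321` + no fixed point under an arc -/

/-- ★ **PROPOSITION 3 (Barnabei–Bonetti–Silimbani), arc form.** An involution avoids `321` iff it avoids `4321` (its
arcs do not nest) and none of its fixed points lies under an arc (all horizontal steps of its Motzkin path are at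
height `0`). [cite: BarnabeiBonettiSilimbani2011, Proposition 3 (arXiv 0812.0463)] -/
theorem not_contains_321_iff_not_contains_4321 {u : Perm (Fin n)} (hu : ∀ x, u (u x) = x) :
    ¬ PermContainsPattern u ![3, 2, 1] ↔
      ¬ PermContainsPattern u ![4, 3, 2, 1] ∧ ∀ i f : Fin n, i < f → f < u i → u f = f → False := by
  rw [not_contains_321_iff_nonnesting hu, not_contains_4321_iff_nonnesting hu]

/-- A `321`-avoiding involution avoids `4321` («as seen above, in this case `τ` contains a `4321`-subsequence, and hence
contains also the pattern `321`»). [cite: BarnabeiBonettiSilimbani2011, Proposition 3 (proof; arXiv 0812.0463)] -/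
theorem not_contains_4321_of_not_contains_321 {u : Perm (Fin n)} (hu : ∀ x, u (u x) = x)
    (h : ¬ PermContainsPattern u ![3, 2, 1]) : ¬ PermContainsPattern u ![4, 3, 2, 1] :=
  ((not_contains_321_iff_not_contains_4321 hu).1 h).1

/-- Hence `I_n(321) ≤ I_n(4321)`. [cite: BarnabeiBonettiSilimbani2011, Proposition 3 and §6 («DI_n(321) ⊆ DI_n(4321)»; arXiv 0812.0463)] -/
theorem card_involutions_av321_le_av4321 (n : ℕ) :
    Nat.card {u : Perm (Fin n) // u * u = 1 ∧ ¬ PermContainsPattern u ![3, 2, 1]} ≤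
      Nat.card {u : Perm (Fin n) // u * u = 1 ∧ ¬ PermContainsPattern u ![4, 3, 2, 1]} :=
  Nat.card_le_card_of_injective
    (fun u => ⟨u.1, u.2.1, not_contains_4321_of_not_contains_321 ((mul_self_eq_one_iff_apply_apply u.1).1 u.2.1) u.2.2⟩)
    fun u u' h => by have h' := Subtype.ext_iff.1 h; exact Subtype.ext h'

/-- `binom(n, ⌊n/2⌋) ≤ I_n(4321)` (the left side being `I_n(321)`, Simion–Schmidt).
[cite: BarnabeiBonettiSilimbani2011, Theorem 6 (ii) (arXiv 0812.0463)] -/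
theorem choose_half_le_card_involutions_av4321 (n : ℕ) :
    n.choose (n / 2) ≤ Nat.card {u : Perm (Fin n) // u * u = 1 ∧ ¬ PermContainsPattern u ![4, 3, 2, 1]} := by
  rw [← card_involutions_av321]
  exact card_involutions_av321_le_av4321 n

/-! ### §4 Fixed-point-free involutions: PROPOSITION 11 and THEOREM 10 -/

/-- For a FIXED-POINT-FREE involution, avoiding `321` and avoiding `4321` are the same condition (nonnesting arcs).
[cite: BarnabeiBonettiSilimbani2011, Proposition 11 (arXiv 0812.0463)] -/
theorem fpf_not_contains_321_iff_not_contains_4321 {u : Perm (Fin n)} (hu : ∀ x, u (u x) = x) (hfp : ∀ i, u i ≠ i) :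
    ¬ PermContainsPattern u ![3, 2, 1] ↔ ¬ PermContainsPattern u ![4, 3, 2, 1] := by
  rw [not_contains_321_iff_not_contains_4321 hu]
  exact ⟨fun h => h.1, fun h => ⟨h, fun _ f _ _ hf => hfp f hf⟩⟩

/-- ★ **PROPOSITION 11 (Barnabei–Bonetti–Silimbani): `DI_n(321) = DI_n(4321)`** — the fixed-point-free involutions
avoiding `321` and those avoiding `4321` are the same set. [cite: BarnabeiBonettiSilimbani2011, Proposition 11 (arXiv 0812.0463)] -/
theorem setOf_fpf_involutions_av321_eq_av4321 (n : ℕ) :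
    {u : Perm (Fin n) | (u * u = 1 ∧ ¬ PermContainsPattern u ![3, 2, 1]) ∧ ∀ i, u i ≠ i} =
      {u : Perm (Fin n) | (u * u = 1 ∧ ¬ PermContainsPattern u ![4, 3, 2, 1]) ∧ ∀ i, u i ≠ i} := by
  ext u
  simp only [Set.mem_setOf_eq]
  constructor
  · rintro ⟨⟨hinv, hav⟩, hfp⟩
    exact ⟨⟨hinv, (fpf_not_contains_321_iff_not_contains_4321 ((mul_self_eq_one_iff_apply_apply u).1 hinv) hfp).1
      hav⟩, hfp⟩
  · rintro ⟨⟨hinv, hav⟩, hfp⟩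
    exact ⟨⟨hinv, (fpf_not_contains_321_iff_not_contains_4321 ((mul_self_eq_one_iff_apply_apply u).1 hinv) hfp).2
      hav⟩, hfp⟩

/-- A fixed-point-free involution avoids `4321` iff it is a nonnesting perfect matching (`⇑u ∈ nestFreeMatchings n`).
[cite: BarnabeiBonettiSilimbani2011, Theorems 2 and 10 (arXiv 0812.0463)] -/
theorem coe_mem_nestFreeMatchings_iff_av4321 (u : Perm (Fin n)) :
    (⇑u) ∈ nestFreeMatchings n ↔ (u * u = 1 ∧ ¬ PermContainsPattern u ![4, 3, 2, 1]) ∧ ∀ i, u i ≠ i := by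
  rw [coe_mem_nestFreeMatchings_iff]
  constructor
  · rintro ⟨⟨hinv, hav⟩, hfp⟩
    exact ⟨⟨hinv, (fpf_not_contains_321_iff_not_contains_4321 ((mul_self_eq_one_iff_apply_apply u).1 hinv) hfp).1
      hav⟩, hfp⟩
  · rintro ⟨⟨hinv, hav⟩, hfp⟩
    exact ⟨⟨hinv, (fpf_not_contains_321_iff_not_contains_4321 ((mul_self_eq_one_iff_apply_apply u).1 hinv) hfp).2
      hav⟩, hfp⟩

/-- `|DI_n(4321)| = |DI_n(321)|` (the same set). [cite: BarnabeiBonettiSilimbani2011, Proposition 11 (arXiv 0812.0463)] -/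
theorem card_fpf_involutions_av4321_eq_av321 (n : ℕ) :
    Nat.card {u : Perm (Fin n) // (u * u = 1 ∧ ¬ PermContainsPattern u ![4, 3, 2, 1]) ∧ ∀ i, u i ≠ i} =
      Nat.card {u : Perm (Fin n) // (u * u = 1 ∧ ¬ PermContainsPattern u ![3, 2, 1]) ∧ ∀ i, u i ≠ i} := by
  have h := setOf_fpf_involutions_av321_eq_av4321 n
  exact Nat.card_congr (Equiv.setCongr h.symm)

/-- ★★ **THEOREM 10 (Barnabei–Bonetti–Silimbani): `|DI_{2h}(4321)| = C_h`** — the fixed-point-free `4321`-avoiding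
involutions of `[2h]` are the nonnesting perfect matchings, counted by the Catalan number (in the tree through
`card_nestFreeMatchings_two_mul`, i.e. Dyck words of semilength `h`).
[cite: BarnabeiBonettiSilimbani2011, Theorem 10 (arXiv 0812.0463)] -/
theorem card_fpf_involutions_av4321_two_mul (h : ℕ) :
    Nat.card {u : Perm (Fin (2 * h)) // (u * u = 1 ∧ ¬ PermContainsPattern u ![4, 3, 2, 1]) ∧ ∀ i, u i ≠ i} =
      catalan h := by
  rw [card_fpf_involutions_av4321_eq_av321, card_fpf_involutions_av321_two_mul]

/-- «this set is nonempty if and only if `n = 2h` is even»: no fixed-point-free involution of an odd number of letters.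
[cite: BarnabeiBonettiSilimbani2011, §6 (arXiv 0812.0463)] -/
theorem card_fpf_involutions_av4321_odd (h : ℕ) :
    Nat.card {u : Perm (Fin (2 * h + 1)) // (u * u = 1 ∧ ¬ PermContainsPattern u ![4, 3, 2, 1]) ∧ ∀ i, u i ≠ i} = 0 := by
  rw [card_fpf_involutions_av4321_eq_av321, card_fpf_involutions_av321_odd]

/-- The fixed-point-free `4321`-avoiding involutions of `[m]` are equinumerous with the nonnesting perfect matchings of
`[m]`: `catalan (m/2)` for `m` even, `0` for `m` odd. [cite: BarnabeiBonettiSilimbani2011, Theorem 10 (arXiv 0812.0463)] -/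
theorem card_fpf_involutions_av4321_eq_ite (m : ℕ) :
    Nat.card {u : Perm (Fin m) // (u * u = 1 ∧ ¬ PermContainsPattern u ![4, 3, 2, 1]) ∧ ∀ i, u i ≠ i} =
      if m % 2 = 0 then catalan (m / 2) else 0 := by
  rw [card_fpf_involutions_av4321_eq_av321, card_fpf_involutions_av321_eq_ite]

/-! ### §5 THEOREM 6 (ii): `|I_n(4321, 321)| = binom(n, ⌊n/2⌋)` -/

/-- **THEOREM 6 (ii) (Barnabei–Bonetti–Silimbani)**: `|I_n(4321, 321)| = binom(n, ⌊n/2⌋)` («Obviously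
`I_n(4321,321) = I_n(321)`. It is well known [Simion–Schmidt] that the cardinality of this set is the central binomial
coefficient»). [cite: BarnabeiBonettiSilimbani2011, Theorem 6 (ii) (arXiv 0812.0463)] -/
theorem card_involutions_av4321_av321 (n : ℕ) :
    Nat.card {u : Perm (Fin n) // u * u = 1 ∧ ¬ PermContainsPattern u ![4, 3, 2, 1] ∧ ¬ PermContainsPattern u ![3, 2, 1]} =
      n.choose (n / 2) := by
  rw [← card_involutions_av321 n]
  refine Nat.card_congr (Equiv.subtypeEquivRight fun u => ?_)
  constructor
  · rintro ⟨hinv, -, h321⟩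
    exact ⟨hinv, h321⟩
  · rintro ⟨hinv, h321⟩
    exact ⟨hinv, not_contains_4321_of_not_contains_321 ((mul_self_eq_one_iff_apply_apply u).1 hinv) h321, h321⟩

end PermContainsPattern

end Literature.Combinatorics.Enumerative
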